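import Summits.Ventures.YMGap.RobustBall.StarKernelSusceptibility
import Summits.Ventures.YMGap.RobustBall.OneStateBoundary
import Summits.Ventures.YMGap.RobustBall.BoundaryDecayTorus
import Summits.Ventures.YMGap.Thresholds.ImprovedThresholdStar
import Mathlib.Analysis.Normed.Group.Tannery
import HarnessLib

/-!
# Venture YMGap, track DS (seat ds-3) — «C-KMIX-STAR», step 4: the finite-volume plaquette susceptibility on centred boxes
# with ARBITRARY boundary fields converges to the infinite-volume susceptibility; `SU(2)`, `d = 4`, Wilson, every `0 ≤ β_W ≤ 9/25`

HONEST FRAMING. WHAT THIS IS: a venture file (cell `pub-ymgap`, track DS, seat ds-3; one theorem, no `def`, no named fact):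
the star-window twin of the seat's `KernelSusceptibilityLimit.lean` (`β_W ≤ 1/12`, all volumes). For `SU(2)` lattice Yang–Mills on `ℤ⁴`
with the Wilson action at every `0 ≤ β_W ≤ 9/25` (tree coupling `β_W/2`) the DLR states form a singleton `{μ}` (ds-1's improved star
threshold `ImprovedThresholdStar.su2_massGapAt_of_abs_le`), every finite-volume Gibbs distribution converges to `μ` on bounded continuous
observables UNIFORMLY IN THE BOUNDARY FIELD (the seat's `boundaryLimit_of_massGapAt`), and the box kernels cluster with ONE summable
plaquette majorant for all boxes `M > ‖x_p‖_∞` and all boundary fields (`StarKernelSusceptibility.abs_cov_plaquette_kernel_box_le_of_starWindowBoundZd`).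
Tannery's theorem (Mathlib `tendsto_tsum_of_dominated_convergence`) then gives
* ★★★ `su2_wilson_kernel_susceptibility_star_tendsto` — for EVERY sequence of boundary fields `η_M` and every plaquette `p`:
  `Σ_{q based in box M} cov_{γ_{box M}(·|η_M)}(W_p, W_q) ⟶ Σ_q cov_μ(W_p, W_q)` as `M → ∞`, the limit row being absolutely summable:
  the thermodynamic limit of the plaquette susceptibility EXISTS, is FINITE and is INDEPENDENT OF THE BOUNDARY CONDITIONS, at every
  `β_W ≤ 9/25` (was `1/12`).
WHAT THIS IS NOT: no rate here (the rate version needs the depth bookkeeping of `KernelSusceptibilityRate.lean`); strong-coupling LATTICE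
statements; nothing about the continuum limit or the Clay Millennium problem.

References: J. Tannery (1904) / Mathlib `Mathlib.Analysis.Normed.Group.Tannery`; B. Simon, *The Statistical Mechanics of Lattice Gases* I (1993)
§II.12, §III.2; R. L. Dobrushin, S. B. Shlosman (1985), (1987); the seat's `StarKernelSusceptibility.lean`, `OneStateBoundary.lean`,
`KernelSusceptibilityLimit.lean`; ds-1's `ImprovedThresholdStar.lean`.
-/

noncomputable section

open MeasureTheory ProbabilityTheory Function Finset Real Filter
open scoped NNReal Topology
open Literature.Probability.LatticeModels
open Literature.Probability.LatticeModels.DobrushinMetric (IsLipBound integrable_of_abs_le')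
open Literature.MathematicalPhysics.QuantumLattice
open Literature.MathematicalPhysics.QuantumFieldTheory hiding ZdEdge
open Summit.Ventures.YMGap.DSWindowZd
open Summit.Ventures.YMGap.StarWindowGauge (gaugeR gaugeR_lt_one_of_le)
open Summit.Ventures.YMGap.StarLemmaG (starWindowBound_lemmaG gaugeR_nonneg)

namespace Summit.Ventures.YMGap.RobustBall

/-- ★★★ **`SU(2)`, `d = 4`, WILSON, EVERY `0 ≤ β_W ≤ 9/25`: THE FINITE-VOLUME PLAQUETTE SUSCEPTIBILITY ON CENTRED BOXES, WITH ARBITRARY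
BOUNDARY FIELDS, CONVERGES TO THE (FINITE, ABSOLUTELY SUMMABLE) INFINITE-VOLUME SUSCEPTIBILITY.** The DLR states at tree coupling `β_W/2`
form a singleton `{μ}`, and for EVERY sequence of boundary fields `η_M` and every plaquette `p` of `ℤ⁴`: the row `q ↦ cov_μ(W_p, W_q)` is
summable over all plaquettes and `Σ_{q based in box M} cov_{γ_{box M}(·|η_M)}(W_p, W_q) → Σ_q cov_μ(W_p, W_q)` (`M → ∞`). [folklore] -/
theorem su2_wilson_kernel_susceptibility_star_tendsto {βW : ℝ} (h0 : 0 ≤ βW) (h : βW ≤ 9 / 25) :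
    ∃ μ : Measure (LGConfig 4 (SUN 2)),
      ymGibbsMeasures (d := 4) (fundamentalRep (Fin 2)) (βW / 2) = {μ} ∧
      ∀ (ηs : ℕ → LGConfig 4 (SUN 2)) (p : ZdPlaquette 4),
        (Summable fun q : ZdPlaquette 4 =>
            cov[zdPlaquetteObs (fundamentalRep (Fin 2)) p.1 p.2.1.1 p.2.1.2,
              zdPlaquetteObs (fundamentalRep (Fin 2)) q.1 q.2.1.1 q.2.1.2; μ]) ∧
        Tendsto (fun M : ℕ => ∑ q ∈ (box 4 M) ×ˢ (Finset.univ : Finset {o : Fin 4 × Fin 4 // o.1 < o.2}),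
            cov[zdPlaquetteObs (fundamentalRep (Fin 2)) p.1 p.2.1.1 p.2.1.2,
              zdPlaquetteObs (fundamentalRep (Fin 2)) q.1 q.2.1.1 q.2.1.2;
              ymSpecification (d := 4) (fundamentalRep (Fin 2)) (βW / 2)
                ((box 4 M) ×ˢ (Finset.univ : Finset (Fin 4))) (ηs M)]) atTop
          (𝓝 (∑' q : ZdPlaquette 4, cov[zdPlaquetteObs (fundamentalRep (Fin 2)) p.1 p.2.1.1 p.2.1.2,
              zdPlaquetteObs (fundamentalRep (Fin 2)) q.1 q.2.1.1 q.2.1.2; μ])) := by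
  classical
  -- the unique state and the boundary-limit theorem (improved star threshold `|β_W/4| ≤ 9/100`)
  have hβ : |βW / 4| ≤ 9 / 100 := by rw [abs_of_nonneg (by linarith)]; linarith
  obtain ⟨μ, hG, hlim⟩ := boundaryLimit_of_massGapAt (d := 4) (ImprovedThresholdStar.su2_massGapAt_of_abs_le hβ)
  have e2 : (((2 : ℕ) : ℝ) * (βW / 4) : ℝ) = βW / 2 := by push_cast; ring
  rw [e2] at hG hlim
  have hμ : μ ∈ ymGibbsMeasures (d := 4) (fundamentalRep (Fin 2)) (βW / 2) := by rw [hG]; exact Set.mem_singleton μ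
  have hμG : IsGibbsMeasure (ymSpecification (d := 4) (fundamentalRep (Fin 2)) (βW / 2)) μ := hμ
  haveI := hμG.isProbabilityMeasure
  refine ⟨μ, hG, fun ηs p => ?_⟩
  -- the centred boxes are cofinal
  set Λs : ℕ → Finset (ZdEdge 4) := fun M => (box 4 M) ×ˢ (Finset.univ : Finset (Fin 4)) with hΛs
  have hcof : ∀ Δ : Finset (ZdEdge 4), ∀ᶠ n in atTop, Δ ⊆ Λs n := by
    intro Δ
    refine eventually_atTop.2 ⟨Δ.sup fun e => supNormZd e.1, fun n hn e he => ?_⟩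
    refine Finset.mem_product.2 ⟨mem_box.2 fun i => ?_, Finset.mem_univ _⟩
    have h1 : supNormZd e.1 ≤ n := (Finset.le_sup (f := fun e : ZdEdge 4 => supNormZd e.1) he).trans hn
    have h3 := natAbs_le_supNormZd e.1 i
    omega
  obtain ⟨hF, -⟩ := hlim Λs hcof
  set γ := ymSpecification (d := 4) (fundamentalRep (Fin 2)) (βW / 2) with hγdef
  haveI hγprob : ∀ Λ η, IsProbabilityMeasure (γ Λ η) := fun Λ η =>
    isProbabilityMeasure_ymSpecification _ (continuous_fundamentalRep (Fin 2)) _ Λ η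
  set W : ZdPlaquette 4 → LGConfig 4 (SUN 2) → ℝ :=
    fun r => zdPlaquetteObs (fundamentalRep (Fin 2)) r.1 r.2.1.1 r.2.1.2 with hW
  -- plaquette observables: continuous, bounded by one, in `L²` of every probability measure
  have hWc : ∀ r : ZdPlaquette 4, Continuous (W r) := fun r =>
    continuous_of_isLipschitzCylinder (isLipschitzCylinder_zdPlaquetteObs (N := 2) r.1 r.2.2)
  have hWb : ∀ r : ZdPlaquette 4, ∀ U, |W r U| ≤ 1 := fun r U =>
    abs_zdPlaquetteObs_le fundamentalRep_mem_unitaryGroup r.1 r.2.1.1 r.2.1.2 U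
  have hWmem : ∀ (r : ZdPlaquette 4) (ν : Measure (LGConfig 4 (SUN 2))) [IsProbabilityMeasure ν], MemLp (W r) 2 ν :=
    fun r ν _ => memLp_of_bounded (a := -1) (b := 1)
      (ae_of_all _ fun U => by simp only [Set.mem_Icc]; exact abs_le.1 (hWb r U)) (hWc r).measurable.aestronglyMeasurable 2
  -- termwise convergence of the covariances along the boxes, for every sequence of boundary fields
  have hcovlim : ∀ q : ZdPlaquette 4, Tendsto (fun n => cov[W p, W q; γ (Λs n) (ηs n)]) atTop (𝓝 (cov[W p, W q; μ])) := by
    intro q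
    have h1 := hF ηs (fun U => W p U * W q U) ((hWc p).mul (hWc q))
      ⟨1, fun U => by rw [abs_mul]; exact mul_le_one₀ (hWb p U) (abs_nonneg _) (hWb q U)⟩
    have h2 := hF ηs (W p) (hWc p) ⟨1, hWb p⟩
    have h3 := hF ηs (W q) (hWc q) ⟨1, hWb q⟩
    have hcovn : ∀ n, cov[W p, W q; γ (Λs n) (ηs n)] =
        (∫ U, W p U * W q U ∂(γ (Λs n) (ηs n))) - (∫ U, W p U ∂(γ (Λs n) (ηs n))) * ∫ U, W q U ∂(γ (Λs n) (ηs n)) :=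
      fun n => covariance_eq_sub (hWmem p _) (hWmem q _)
    have hcovμ : cov[W p, W q; μ] = (∫ U, W p U * W q U ∂μ) - (∫ U, W p U ∂μ) * ∫ U, W q U ∂μ :=
      covariance_eq_sub (hWmem p _) (hWmem q _)
    simp_rw [hcovn, hcovμ]
    exact h1.sub (h2.mul h3)
  -- the truncated rows `f M q = 𝟙[q based in box M] · cov_M`
  set S : ℕ → Finset (ZdPlaquette 4) := fun M => (box 4 M) ×ˢ (Finset.univ : Finset {o : Fin 4 × Fin 4 // o.1 < o.2}) with hS
  have hSmem : ∀ q : ZdPlaquette 4, ∀ᶠ M in atTop, q ∈ S M := by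
    intro q
    refine eventually_atTop.2 ⟨supNormZd q.1, fun M hM => ?_⟩
    refine Finset.mem_product.2 ⟨mem_box.2 fun i => ?_, Finset.mem_univ _⟩
    have h3 := natAbs_le_supNormZd q.1 i
    omega
  have hterm : ∀ q : ZdPlaquette 4,
      Tendsto (fun M => if q ∈ S M then cov[W p, W q; γ (Λs M) (ηs M)] else 0) atTop (𝓝 (cov[W p, W q; μ])) := by
    intro q
    refine (hcovlim q).congr' ?_
    filter_upwards [hSmem q] with M hM
    rw [if_pos hM]
  -- uniform domination on the boxes `M > P = ‖x_p‖_∞` (the star kernel door, saturation absorbed)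
  set P : ℕ := supNormZd p.1 with hP
  have hp : p.1 ∈ box 4 P := mem_box.2 fun i => by have := natAbs_le_supNormZd p.1 i; omega
  have hρ0 : 0 ≤ gaugeR βW := gaugeR_nonneg h0 (by linarith)
  have hρ1 : gaugeR βW < 1 := gaugeR_lt_one_of_le h0 h
  have hZd : StarWindowBoundZd 4 2 (βW / 2) (gaugeR βW) suFrobDist :=
    starWindowBoundZd_of_starWindowBound (L := 5) le_rfl suFrobDist_nonneg (starWindowBound_lemmaG (by norm_num) h0 (by linarith))
  set t : ℝ := -Real.log (max (gaugeR βW) (1 / 2)) with ht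
  have ht0 : 0 < t := by
    rw [ht, neg_pos]
    exact Real.log_neg (lt_max_of_lt_right (by norm_num)) (max_lt hρ1 (by norm_num))
  set C : ℝ := 2048 * ((2 : ℕ) : ℝ) ^ 7 * Real.exp (t * (P / 2 + 3 / 2)) with hC
  have hC0 : 0 ≤ C := by positivity
  set r : ℝ := Real.exp (-(t / 4 / (4 : ℕ))) with hr
  have hr0 : 0 ≤ r := (Real.exp_pos _).le
  have hr1 : r < 1 := by
    rw [hr]
    exact Real.exp_lt_one_iff.2 (neg_neg_of_pos (by positivity))
  have hbound : ∀ᶠ M in atTop, ∀ q : ZdPlaquette 4,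
      ‖(if q ∈ S M then cov[W p, W q; γ (Λs M) (ηs M)] else 0)‖ ≤ C * r ^ l1 (p.1 - q.1) := by
    refine eventually_atTop.2 ⟨P + 1, fun M hM q => ?_⟩
    rw [Real.norm_eq_abs]
    split_ifs with hq
    · have hq1 : q.1 ∈ box 4 M := (Finset.mem_product.1 hq).1
      have hPM : P < M := by omega
      refine (abs_cov_plaquette_kernel_box_le_of_starWindowBoundZd (d := 4) (N := 2) hρ0 hρ1 hZd hPM (ηs M) hp hq1).trans ?_
      rw [← ht]
      refine mul_le_mul_of_nonneg_left ?_ hC0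
      have := exp_neg_norm_le_pow (d := 4) (by norm_num) (m := t / 4) (by positivity) (p.1 - q.1)
      rw [hr]
      convert this using 2
    · rw [abs_zero]; positivity
  have hsumb : Summable fun q : ZdPlaquette 4 => C * r ^ l1 (p.1 - q.1) := (summable_and_tsum_row_le (d := 4) hC0 hr0 hr1 p).1
  -- Tannery
  have hT := tendsto_tsum_of_dominated_convergence hsumb hterm hbound
  -- the truncated `tsum` IS the finite box sum
  have hfin : ∀ M, ∑' q : ZdPlaquette 4, (if q ∈ S M then cov[W p, W q; γ (Λs M) (ηs M)] else 0) =
      ∑ q ∈ S M, cov[W p, W q; γ (Λs M) (ηs M)] := by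
    intro M
    rw [tsum_eq_sum (s := S M) (fun q hq => if_neg hq)]
    exact Finset.sum_congr rfl fun q hq => if_pos hq
  refine ⟨?_, hT.congr fun M => hfin M⟩
  -- summability of the limit row: the majorant passes to the limit
  refine Summable.of_norm_bounded hsumb fun q => ?_
  rw [Real.norm_eq_abs]
  refine le_of_tendsto ((hterm q).abs) ?_
  filter_upwards [hbound] with M hM
  have := hM q
  rwa [Real.norm_eq_abs] at this

end Summit.Ventures.YMGap.RobustBall

end
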